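import Mathlib.NumberTheory.LSeries.PrimesInAP

/-!
# SoloInformedResidueClassMertens — `∑_{p ≡ a (q)} 1/p` diverges; `∏_{p ≡ a (q), p ∈ S} (1 - 1/p)` can be made small

Solo unit `solo-Parity-informed` (ideation tier, informed mode), session 14; `PLAN.md` §22.5(a), CLAIMS C62.

From Mathlib's quantitative input to Dirichlet's theorem
(`ArithmeticFunction.vonMangoldt.LSeries_residueClass_lower_bound`:
`φ(q)⁻¹/(x-1) - C ≤ ∑ₙ Λ_a(n)/nˣ` for `x ∈ (1,2]`) we derive, by a tail-splitting argument
(`log p / p^{x-1} ≤ 1/(x-1)`), that `∑_{p prime, p ≡ a (q)} 1/p` diverges for every unit class `a`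
(`not_summable_prime_residueClass_one_div`; note that divergence of `∑ log p / p` over a set of primes does
not by itself give divergence of `∑ 1/p`).  Consequently (`exists_finset_prime_residueClass_prod_le`) for
every `η > 0` and every `N₀` there is a finite set `S` of primes `p ≡ a (q)`, `p > N₀`, with
`∏_{p ∈ S} (1 - 1/p) ≤ η` — the local-density input of the one-non-residue sieve of §22.5(a).
-/

namespace Summit.Parity.BatemanHorn.Theorems

open Finset Filter ArithmeticFunction
open scoped Topology

/-- **`∑_{p ≡ a (q)} 1/p` diverges** for every unit residue class `a (mod q)`. -/
theorem not_summable_prime_residueClass_one_div {q : ℕ} [NeZero q] {a : ZMod q} (ha : IsUnit a) :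
    ¬ Summable (fun n : ℕ => if n.Prime ∧ (n : ZMod q) = a then (1 : ℝ) / n else 0) := by
  intro hsum
  set f : ℕ → ℝ := fun n => if n.Prime ∧ (n : ZMod q) = a then (1 : ℝ) / n else 0 with hf
  have hf0 : ∀ n, 0 ≤ f n := fun n => by simp only [hf]; split_ifs <;> positivity
  have hφ : 0 < (q.totient : ℝ)⁻¹ :=
    inv_pos.mpr (by exact_mod_cast Nat.totient_pos.mpr (NeZero.pos q))
  set ε : ℝ := (q.totient : ℝ)⁻¹ / 2 with hε
  have hε0 : 0 < ε := by positivity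
  -- a tail of `f` below `ε`
  obtain ⟨P, hP⟩ : ∃ P : ℕ, ∑' k, f (k + P) < ε :=
    (((tendsto_order.1 (tendsto_sum_nat_add f)).2 ε hε0)).exists
  set F : ℕ → ℝ := fun n => if P ≤ n then f n else 0 with hF
  have hF0 : ∀ n, 0 ≤ F n := fun n => by simp only [hF]; split_ifs; exacts [hf0 n, le_rfl]
  have hFP : (fun n => F (n + P)) = fun n => f (n + P) := by
    ext n; simp [hF]
  have hFsum : Summable F := (summable_nat_add_iff P).mp (hFP ▸ (summable_nat_add_iff P).mpr hsum)
  have hFtsum : ∑' n, F n < ε := by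
    rw [← hFsum.sum_add_tsum_nat_add P, hFP]
    have : ∑ i ∈ range P, F i = 0 := sum_eq_zero fun i hi => by
      rw [mem_range] at hi; simp [hF, Nat.not_le.mpr hi]
    rw [this, zero_add]; exact hP
  -- the constants
  set C₁ : ℝ := ∑' n : ℕ, (if n.Prime then 0 else vonMangoldt.residueClass a n) / (n : ℝ) with hC₁
  set B : ℝ := ∑ n ∈ range (P + 1), Λ n / (n : ℝ) with hB
  obtain ⟨C, hC⟩ := vonMangoldt.LSeries_residueClass_lower_bound ha
  -- upper bound of the class series for `x > 1`
  have hub : ∀ x : ℝ, 1 < x →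
      ∑' n, vonMangoldt.residueClass a n / (n : ℝ) ^ x ≤ C₁ + B + (x - 1)⁻¹ * ε := by
    intro x hx
    have hx1 : 0 < x - 1 := sub_pos.mpr hx
    refine Real.tsum_le_of_sum_le (fun n => ?_) fun u => ?_
    · exact div_nonneg (vonMangoldt.residueClass_nonneg a n) (Real.rpow_nonneg (Nat.cast_nonneg n) x)
    -- pointwise domination
    have hpt : ∀ n : ℕ, vonMangoldt.residueClass a n / (n : ℝ) ^ x ≤
        (if n.Prime then 0 else vonMangoldt.residueClass a n) / n
          + (if n < P + 1 then Λ n / n else 0) + (x - 1)⁻¹ * F n := by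
      intro n
      have hnpp : 0 ≤ (if n.Prime then 0 else vonMangoldt.residueClass a n) / n := by
        positivity [vonMangoldt.residueClass_nonneg a n]
      have hhead : 0 ≤ (if n < P + 1 then Λ n / n else 0) := by
        split_ifs
        · exact div_nonneg vonMangoldt_nonneg (Nat.cast_nonneg n)
        · exact le_rfl
      have htail : 0 ≤ (x - 1)⁻¹ * F n := mul_nonneg (inv_nonneg.mpr hx1.le) (hF0 n)
      rcases Nat.eq_zero_or_pos n with rfl | hn
      · simp only [vonMangoldt.residueClass_apply_zero, zero_div]
        positivity
      have hn' : (0 : ℝ) < n := by exact_mod_cast hn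
      have hnx : (n : ℝ) ≤ (n : ℝ) ^ x := by
        conv_lhs => rw [← Real.rpow_one n]
        exact Real.rpow_le_rpow_of_exponent_le (by exact_mod_cast hn) hx.le
      by_cases hp : n.Prime
      · by_cases hcl : (n : ZMod q) = a
        · have hres : vonMangoldt.residueClass a n = Real.log n := by
            simp [vonMangoldt.residueClass, hcl, vonMangoldt_apply_prime hp]
          have hlhs : vonMangoldt.residueClass a n / (n : ℝ) ^ x = Real.log n / (n : ℝ) ^ x := by
            rw [hres]
          rw [hlhs]
          by_cases hnP : n < P + 1
          · -- head: `log n / n^x ≤ log n / n = Λ n / n`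
            rw [if_pos hnP, vonMangoldt_apply_prime hp]
            have : Real.log n / (n : ℝ) ^ x ≤ Real.log n / n :=
              div_le_div_of_nonneg_left (Real.log_nonneg (by exact_mod_cast hn)) hn' hnx
            linarith
          · -- tail: `log n / n^x ≤ (x-1)⁻¹ / n = (x-1)⁻¹ f n`
            have hFn : F n = 1 / n := by
              simp only [hF, hf, if_pos (show P ≤ n by omega), if_pos (And.intro hp hcl)]
            rw [hFn]
            have hlog : Real.log n ≤ (n : ℝ) ^ (x - 1) / (x - 1) := Real.log_natCast_le_rpow_div n hx1
            have hsplit : (n : ℝ) ^ x = (n : ℝ) ^ (x - 1) * n := by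
              rw [← Real.rpow_add_one hn'.ne']; ring_nf
            have h1 : Real.log n / (n : ℝ) ^ x ≤ (x - 1)⁻¹ * (1 / n) := by
              rw [hsplit, div_le_iff₀ (by positivity)]
              calc Real.log n ≤ (n : ℝ) ^ (x - 1) / (x - 1) := hlog
                _ = (x - 1)⁻¹ * (1 / n) * ((n : ℝ) ^ (x - 1) * n) := by field_simp
            linarith
        · have : vonMangoldt.residueClass a n = 0 := by
            simp [vonMangoldt.residueClass, hcl]
          rw [this, zero_div]
          positivity
      · -- non-prime: `Λ_a n / n^x ≤ Λ_a n / n`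
        rw [if_neg hp]
        have : vonMangoldt.residueClass a n / (n : ℝ) ^ x ≤ vonMangoldt.residueClass a n / n :=
          div_le_div_of_nonneg_left (vonMangoldt.residueClass_nonneg a n) hn' hnx
        linarith
    -- sum the three pieces over `u`
    have hs1 : ∑ n ∈ u, (if n.Prime then 0 else vonMangoldt.residueClass a n) / (n : ℝ) ≤ C₁ := by
      rw [hC₁]
      exact (vonMangoldt.summable_residueClass_non_primes_div a).sum_le_tsum u
        fun n _ => by positivity [vonMangoldt.residueClass_nonneg a n]
    have hs2 : ∑ n ∈ u, (if n < P + 1 then Λ n / n else 0) ≤ B := by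
      rw [← sum_filter, hB]
      refine sum_le_sum_of_subset_of_nonneg (fun n hn => ?_) fun n _ _ =>
        div_nonneg vonMangoldt_nonneg (Nat.cast_nonneg n)
      rw [mem_filter] at hn
      exact mem_range.mpr hn.2
    have hs3 : ∑ n ∈ u, F n ≤ ε := (hFsum.sum_le_tsum u fun n _ => hF0 n).trans hFtsum.le
    calc ∑ n ∈ u, vonMangoldt.residueClass a n / (n : ℝ) ^ x
        ≤ ∑ n ∈ u, ((if n.Prime then 0 else vonMangoldt.residueClass a n) / n
            + (if n < P + 1 then Λ n / n else 0) + (x - 1)⁻¹ * F n) := sum_le_sum fun n _ => hpt n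
      _ = ∑ n ∈ u, (if n.Prime then 0 else vonMangoldt.residueClass a n) / n
            + ∑ n ∈ u, (if n < P + 1 then Λ n / n else 0) + (x - 1)⁻¹ * ∑ n ∈ u, F n := by
          rw [sum_add_distrib, sum_add_distrib, mul_sum]
      _ ≤ C₁ + B + (x - 1)⁻¹ * ε := by
          gcongr
  -- contradiction as `x → 1⁺`: `ε/(x-1) ≤ C + C₁ + B` for all `x ∈ (1,2]`
  set M : ℝ := C + C₁ + B with hM
  have key : ∀ x : ℝ, x ∈ Set.Ioc (1 : ℝ) 2 → ε / (x - 1) ≤ M := by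
    intro x hx
    have hx1 : 0 < x - 1 := sub_pos.mpr hx.1
    have h1 := (hC hx).trans (hub x hx.1)
    -- `φ⁻¹/(x-1) - C ≤ C₁ + B + ε/(x-1)` and `φ⁻¹ = 2ε`
    have h2 : (q.totient : ℝ)⁻¹ = 2 * ε := by rw [hε]; ring
    rw [h2] at h1
    have h3 : ε / (x - 1) = 2 * ε / (x - 1) - (x - 1)⁻¹ * ε := by field_simp; ring
    rw [h3]
    linarith
  set t : ℝ := min 1 (ε / (|M| + 1)) with ht
  have ht0 : 0 < t := lt_min one_pos (by positivity)
  have ht1 : t ≤ 1 := min_le_left _ _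
  have hx : (1 + t) ∈ Set.Ioc (1 : ℝ) 2 := ⟨by linarith, by linarith⟩
  have h1 := key (1 + t) hx
  rw [add_sub_cancel_left] at h1
  -- `ε / t ≥ |M| + 1 > M`
  have h2 : |M| + 1 ≤ ε / t := by
    rw [le_div_iff₀ ht0]
    calc (|M| + 1) * t ≤ (|M| + 1) * (ε / (|M| + 1)) :=
          mul_le_mul_of_nonneg_left (min_le_right _ _) (by positivity)
      _ = ε := by field_simp
  linarith [le_abs_self M]

/-- **A finite set of primes `p ≡ a (q)`, `p > N₀`, with `∏ (1 - 1/p) ≤ η`.** -/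
theorem exists_finset_prime_residueClass_prod_le {q : ℕ} [NeZero q] {a : ZMod q} (ha : IsUnit a)
    (N₀ : ℕ) {η : ℝ} (hη : 0 < η) :
    ∃ S : Finset ℕ, (∀ p ∈ S, p.Prime ∧ (p : ZMod q) = a ∧ N₀ < p) ∧
      ∏ p ∈ S, (1 - 1 / (p : ℝ)) ≤ η := by
  set F : ℕ → ℝ := fun n : ℕ => if n.Prime ∧ (n : ZMod q) = a ∧ N₀ < n then (1 : ℝ) / (n : ℝ) else 0 with hF
  have hF0 : ∀ n, 0 ≤ F n := fun n => by simp only [hF]; split_ifs <;> positivity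
  -- `F` is not summable (it agrees with the full class beyond `N₀`)
  have hFns : ¬ Summable F := by
    intro hFs
    apply not_summable_prime_residueClass_one_div ha
    refine (summable_nat_add_iff (N₀ + 1)).mp ?_
    have heq : (fun n => if (n + (N₀ + 1)).Prime ∧ ((n + (N₀ + 1) : ℕ) : ZMod q) = a
        then (1 : ℝ) / (n + (N₀ + 1) : ℕ) else 0) = fun n => F (n + (N₀ + 1)) := by
      ext n
      simp only [hF, show N₀ < n + (N₀ + 1) by omega, and_true]
    rw [heq]
    exact (summable_nat_add_iff (N₀ + 1)).mpr hFs
  -- partial sums exceed `-log η`... take `N` with `∑_{n<N} F n ≥ log (1/η)`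
  have htend := (not_summable_iff_tendsto_nat_atTop_of_nonneg hF0).mp hFns
  obtain ⟨N, hN⟩ := (htend.eventually_ge_atTop (Real.log (1 / η))).exists
  set S : Finset ℕ := (range N).filter fun n : ℕ => n.Prime ∧ (n : ZMod q) = a ∧ N₀ < n with hS
  refine ⟨S, fun p hp => (mem_filter.mp hp).2, ?_⟩
  have hsumS : ∑ p ∈ S, (1 : ℝ) / (p : ℝ) = ∑ n ∈ range N, F n := by
    rw [hS, hF, ← sum_filter]
  -- `∏ (1 - 1/p) ≤ exp (-∑ 1/p) ≤ exp (-log (1/η)) = η`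
  calc ∏ p ∈ S, (1 - 1 / (p : ℝ))
      ≤ ∏ p ∈ S, Real.exp (-(1 / (p : ℝ))) := by
        refine prod_le_prod (fun p hp => ?_) fun p _ => by linarith [Real.add_one_le_exp (-(1 / (p : ℝ)))]
        have hp2 : 2 ≤ p := (mem_filter.mp hp).2.1.two_le
        have : (1 : ℝ) / p ≤ 1 := by
          rw [div_le_one (by exact_mod_cast (show 0 < p by omega))]
          exact_mod_cast (show 1 ≤ p by omega)
        linarith
    _ = Real.exp (-∑ n ∈ range N, F n) := by rw [← hsumS, ← Real.exp_sum, sum_neg_distrib]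
    _ ≤ Real.exp (-Real.log (1 / η)) := Real.exp_le_exp.mpr (neg_le_neg hN)
    _ = η := by rw [one_div, Real.log_inv, neg_neg, Real.exp_log hη]

end Summit.Parity.BatemanHorn.Theorems
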